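/- Fleet lead `ym-wcr-19456-p1`, route `WeakCouplingRates`, crux `ColdBoxTwoPointFloorW` (stmt-QuantumFields-19608). -/
import Summits.QuantumFields.YangMills.Theorems.WeakCouplingRatesColdBoxForestGauge

/-!
# Crux `ColdBoxTwoPointFloor(W)`, piece S3c-ii step 1 (integrals): forest gauge fixing preserves product Haar measure, and the
# cold-wall box state in the temporal-forest gauge

* `map_coldFreePart_pi` — **Chatterjee's Lemma 9.3 for the temporal forest of the cold-wall box**: under the product Haar measure
  on `G^Λ`, the free part of the forest-gauge-fixed configuration is product-Haar distributed on `G^{Λ ∖ forest}` (skew product: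
  conditionally on the forest links every free link is a two-sided translate of an independent Haar variable;
  `MeasurePreserving.skew_product`, exactly as in the tree's `AxialGauge.map_freePart_pi`);
* `lintegral_pi_eq_lintegral_coldFree`, `integral_pi_eq_integral_coldFree` — Cor. 9.4: integrals of forest-gauge-invariant
  functions on `G^Λ` are integrals over the free links with the forest set to `1`;
* `coldExt_coldFixBox` — extending the gauge-fixed box configuration by the cold wall is gauge-fixing the extended configuration
  (edges off `Λ` have no interior endpoint, `not_interior_of_not_mem_boxEdges`);
* `integral_boxState_eq_coldFree` — **the cold-wall box state in the temporal-forest gauge**: for a measurable gauge-invariant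
  (`IsZdGaugeInvariant`) observable `F`,
  `∫ F d(boxState ρ β H) = ∫ F(U_v) e^{−βS_Λ(U_v)} dσ^{free}(v) / ∫ e^{−βS_Λ(U_v)} dσ^{free}(v)`, `U_v = coldExt (coldExt₁ v)` (free links `v`,
  forest links `1`, cold wall `1`) — via the tree's kernel formula `integral_ymSpecification` and gauge invariance of the boundary Wilson
  action (`wilsonBoundaryAction_gaugeTransformZd`).  This is the integration space of the one-scale expansion of stub
  `stub_boxDirichletDomination` / `stub_boxGaussianDomination` (index set in bijection with `dirFreeEdges H` of D1').
Source of the method: S. Chatterjee, arXiv:1602.01222 §9 (Lemma 9.3, Cor. 9.4).  Everything proved; no definition; standard axioms.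
-/

set_option autoImplicit false

noncomputable section

open MeasureTheory Finset Function
open Literature.Probability.LatticeModels (Site glueWith glueWith_apply_mem glueWith_apply_not_mem
  measurable_glueWith)
open Literature.MathematicalPhysics.QuantumLattice
open Literature.MathematicalPhysics.QuantumFieldTheory
open Literature.MathematicalPhysics.QuantumFieldTheory.AxialGauge

namespace Summit.QuantumFields.YangMills.Theorems.WeakCouplingRates

variable {G : Type*} [Group G]

section Box

variable {H : ℕ}

/-! ### The skew-product argument (Chatterjee's Lemma 9.3 for the temporal forest) -/

section Integrals

open Measure

variable [TopologicalSpace G] [IsTopologicalGroup G] [CompactSpace G] [MeasurableSpace G] [BorelSpace G]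
  [SecondCountableTopology G]

/-- **Forest gauge fixing preserves the product structure**: under the product Haar measure on `G^Λ`, the free part of
the forest-gauge-fixed configuration is product-Haar distributed on `G^{Λ ∖ forest}` (conditionally on the forest links,
every free link is a two-sided translate of an independent Haar variable). -/
theorem map_coldFreePart_pi :
    (Measure.pi fun _ : ↥(boxEdges 4 (2 * H + 1)) => haarProbability G).map (coldFreePart (H := H)) =
      Measure.pi fun _ : {e : ↥(boxEdges 4 (2 * H + 1)) //
        ¬ (e.1.2 = 0 ∧ ∀ k : Fin 4, 1 ≤ e.1.1 k ∧ e.1.1 k + 1 ≤ 2 * (H : ℤ))} => haarProbability G := by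
  classical
  set p : ↥(boxEdges 4 (2 * H + 1)) → Prop := fun e => (e.1.2 = 0 ∧ ∀ k : Fin 4, 1 ≤ e.1.1 k ∧ e.1.1 k + 1 ≤ 2 * (H : ℤ))
    with hp
  set π := Measure.pi fun _ : ↥(boxEdges 4 (2 * H + 1)) => haarProbability G with hπ
  set π₀ := Measure.pi fun _ : {e : ↥(boxEdges 4 (2 * H + 1)) // p e} => haarProbability G with hπ₀
  set π₁ := Measure.pi fun _ : {e : ↥(boxEdges 4 (2 * H + 1)) // ¬ p e} => haarProbability G with hπ₁
  set e₀ := MeasurableEquiv.piEquivPiSubtypeProd (fun _ : ↥(boxEdges 4 (2 * H + 1)) => G) p with he₀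
  have hmp : MeasurePreserving e₀ π (π₀.prod π₁) := measurePreserving_piEquivPiSubtypeProd _ p
  -- the forest gauge as a function of the forest part only
  set A : ({e : ↥(boxEdges 4 (2 * H + 1)) // p e} → G) → Site 4 → G :=
    fun t x => forestGauge H (coldExt (e₀.symm (t, fun _ => 1))) x with hA
  have hAu : ∀ (u : ColdCfg H) (x : Site 4), forestGauge H (coldExt u) x = A (e₀ u).1 x := by
    intro u x
    refine forestGauge_congr (fun y hy => ?_) x
    have hmem : (y, (0 : Fin 4)) ∈ boxEdges 4 (2 * H + 1) := by
      rw [mem_boxEdges_iff]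
      refine ⟨fun k => ⟨by linarith [(hy k).1], ?_⟩, ?_⟩
      · have := (hy k).2; push_cast; omega
      · have := (hy 0).2; push_cast; omega
    rw [coldExt_apply_mem u ⟨_, hmem⟩, coldExt_apply_mem _ ⟨_, hmem⟩]
    have hpe : p ⟨(y, 0), hmem⟩ := ⟨rfl, hy⟩
    simp [he₀, MeasurableEquiv.piEquivPiSubtypeProd, Equiv.piEquivPiSubtypeProd, hpe]
  have hAm : ∀ x : Site 4, Measurable fun t => A t x := fun x =>
    (measurable_forestGauge x).comp (measurable_coldExt.comp (e₀.symm.measurable.comp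
      (measurable_id.prodMk measurable_const)))
  -- the conditional two-sided translation
  set K : ({e : ↥(boxEdges 4 (2 * H + 1)) // p e} → G) → ({e : ↥(boxEdges 4 (2 * H + 1)) // ¬ p e} → G) →
      ({e : ↥(boxEdges 4 (2 * H + 1)) // ¬ p e} → G) :=
    fun t w e => A t e.1.1.1 * w e * (A t (e.1.1.1 + Pi.single e.1.1.2 1))⁻¹ with hK
  have hKfree : ∀ t w, coldFreePart (e₀.symm (t, w)) = K t w := by
    intro t w
    funext e
    change forestFix H (coldExt (e₀.symm (t, w))) e.1.1 = _
    rw [forestFix_apply, hAu, hAu, e₀.apply_symm_apply, coldExt_apply_mem _ e.1]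
    simp only [hK]
    congr 2
    have hne : ¬ p e.1 := e.2
    simp [he₀, MeasurableEquiv.piEquivPiSubtypeProd, Equiv.piEquivPiSubtypeProd, hne]
  have hKpres : ∀ t, MeasurePreserving (K t) π₁ π₁ := fun t =>
    measurePreserving_pi _ _ fun e =>
      (measurePreserving_mul_right (haarProbability G) _).comp
        (measurePreserving_mul_left (haarProbability G) _)
  have hKmeas : Measurable (Function.uncurry K) := by
    refine measurable_pi_lambda _ fun e => ?_
    exact (((hAm _).comp measurable_fst).mul ((measurable_pi_apply e).comp measurable_snd)).mul
      ((hAm _).comp measurable_fst).inv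
  have hskew : MeasurePreserving (fun q : _ × _ => (q.1, K q.1 q.2)) (π₀.prod π₁) (π₀.prod π₁) :=
    (MeasurePreserving.id π₀).skew_product hKmeas (Filter.Eventually.of_forall fun t => (hKpres t).map_eq)
  have hcomp : coldFreePart ∘ e₀.symm = Prod.snd ∘ fun q : _ × _ => (q.1, K q.1 q.2) := by
    funext ⟨t, w⟩; exact hKfree t w
  calc π.map coldFreePart = ((π₀.prod π₁).map e₀.symm).map coldFreePart := by rw [hmp.symm.map_eq]
    _ = (π₀.prod π₁).map (coldFreePart ∘ e₀.symm) := Measure.map_map measurable_coldFreePart e₀.symm.measurable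
    _ = ((π₀.prod π₁).map fun q : _ × _ => (q.1, K q.1 q.2)).map Prod.snd := by
        rw [hcomp, Measure.map_map measurable_snd hskew.measurable]
    _ = (π₀.prod π₁).map Prod.snd := by rw [hskew.map_eq]
    _ = π₁ := by rw [Measure.map_snd_prod, measure_univ, one_smul]

/-- **Integration in the temporal-forest gauge** (Cor. 9.4 for the cold box): for a measurable `Φ ≥ 0` on `G^Λ` invariant
under the forest gauge fixing, `∫ Φ dσ^Λ = ∫ Φ(1 on the forest, v off it) dσ^{free}(v)`. -/
theorem lintegral_pi_eq_lintegral_coldFree {Φ : ColdCfg (G := G) H → ENNReal} (hΦ : Measurable Φ)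
    (hinv : ∀ u, Φ (coldFixBox u) = Φ u) :
    ∫⁻ u, Φ u ∂(Measure.pi fun _ : ↥(boxEdges 4 (2 * H + 1)) => haarProbability G) =
      ∫⁻ v, Φ (coldExt₁ v) ∂(Measure.pi fun _ : {e : ↥(boxEdges 4 (2 * H + 1)) //
        ¬ (e.1.2 = 0 ∧ ∀ k : Fin 4, 1 ≤ e.1.1 k ∧ e.1.1 k + 1 ≤ 2 * (H : ℤ))} => haarProbability G) := by
  calc ∫⁻ u, Φ u ∂(Measure.pi fun _ : ↥(boxEdges 4 (2 * H + 1)) => haarProbability G)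
      = ∫⁻ u, (Φ ∘ coldExt₁) (coldFreePart u) ∂(Measure.pi fun _ : ↥(boxEdges 4 (2 * H + 1)) => haarProbability G) :=
        lintegral_congr fun u => by rw [Function.comp_apply, ← coldFixBox_eq_coldExt₁_coldFreePart, hinv]
    _ = ∫⁻ v, (Φ ∘ coldExt₁) v ∂((Measure.pi fun _ : ↥(boxEdges 4 (2 * H + 1)) => haarProbability G).map coldFreePart) :=
        (lintegral_map (hΦ.comp measurable_coldExt₁) measurable_coldFreePart).symm
    _ = _ := by rw [map_coldFreePart_pi]; rfl

/-- The same for real-valued (Bochner) integrals of measurable `Ψ` invariant under the forest gauge fixing. -/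
theorem integral_pi_eq_integral_coldFree {Ψ : ColdCfg (G := G) H → ℝ} (hΨ : Measurable Ψ)
    (hinv : ∀ u, Ψ (coldFixBox u) = Ψ u) :
    ∫ u, Ψ u ∂(Measure.pi fun _ : ↥(boxEdges 4 (2 * H + 1)) => haarProbability G) =
      ∫ v, Ψ (coldExt₁ v) ∂(Measure.pi fun _ : {e : ↥(boxEdges 4 (2 * H + 1)) //
        ¬ (e.1.2 = 0 ∧ ∀ k : Fin 4, 1 ≤ e.1.1 k ∧ e.1.1 k + 1 ≤ 2 * (H : ℤ))} => haarProbability G) := by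
  calc ∫ u, Ψ u ∂(Measure.pi fun _ : ↥(boxEdges 4 (2 * H + 1)) => haarProbability G)
      = ∫ u, (Ψ ∘ coldExt₁) (coldFreePart u) ∂(Measure.pi fun _ : ↥(boxEdges 4 (2 * H + 1)) => haarProbability G) :=
        integral_congr_ae (ae_of_all _ fun u => by
          simp only [Function.comp_apply]; rw [← coldFixBox_eq_coldExt₁_coldFreePart, hinv])
    _ = ∫ v, (Ψ ∘ coldExt₁) v ∂((Measure.pi fun _ : ↥(boxEdges 4 (2 * H + 1)) => haarProbability G).map coldFreePart) :=
        (integral_map measurable_coldFreePart.aemeasurable (hΨ.comp measurable_coldExt₁).aestronglyMeasurable).symm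
    _ = _ := by rw [map_coldFreePart_pi]; rfl

end Integrals

end Box

/-! ## The cold-wall box state in the temporal-forest gauge -/

section BoxState

variable {H : ℕ}

/-- An edge off the cold box has NO interior endpoint. -/
theorem not_interior_of_not_mem_boxEdges {x : Site 4} {i : Fin 4} (h : (x, i) ∉ boxEdges 4 (2 * H + 1)) :
    (¬ ∀ k : Fin 4, 1 ≤ x k ∧ x k + 1 ≤ 2 * (H : ℤ)) ∧
      ¬ ∀ k : Fin 4, 1 ≤ (x + Pi.single i (1 : ℤ) : Site 4) k ∧ (x + Pi.single i (1 : ℤ) : Site 4) k + 1 ≤ 2 * (H : ℤ) := by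
  rw [mem_boxEdges_iff] at h
  constructor
  · intro hx
    apply h
    refine ⟨fun k => ⟨by linarith [(hx k).1], by have := (hx k).2; push_cast; omega⟩, ?_⟩
    have := (hx i).2; push_cast; omega
  · intro hx
    apply h
    refine ⟨fun k => ?_, ?_⟩
    · have h1 := hx k
      by_cases hk : k = i
      · subst hk; simp only [Pi.add_apply, Pi.single_eq_same] at h1; push_cast; omega
      · simp only [Pi.add_apply, Pi.single_eq_of_ne hk, add_zero] at h1; push_cast; omega
    · have h1 := hx i; simp only [Pi.add_apply, Pi.single_eq_same] at h1; push_cast; omega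

/-- Extending the gauge-fixed box configuration by the cold wall = gauge-fixing the extended configuration. -/
theorem coldExt_coldFixBox (u : ColdCfg (G := G) H) : coldExt (coldFixBox u) = forestFix H (coldExt u) := by
  funext e
  by_cases he : e ∈ boxEdges 4 (2 * H + 1)
  · rw [coldExt_apply_mem _ ⟨e, he⟩]; rfl
  · rw [coldExt_apply_not_mem _ he, forestFix_apply, coldExt_apply_not_mem _ he]
    obtain ⟨x, i⟩ := e
    obtain ⟨h1, h2⟩ := not_interior_of_not_mem_boxEdges (H := H) he
    rw [forestGauge_of_not_interior _ h1, forestGauge_of_not_interior _ h2]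
    group

variable {N : ℕ} [TopologicalSpace G] [IsTopologicalGroup G] [CompactSpace G] [MeasurableSpace G] [BorelSpace G]
  [SecondCountableTopology G] (ρ : G →* Matrix (Fin N) (Fin N) ℂ)

/-- **The cold-wall box state in the temporal-forest gauge.**  For a measurable gauge-invariant observable `F`,
`∫ F d(boxState ρ β H) = ∫ F(U_v) e^{−β S_Λ(U_v)} dσ^{free}(v) / ∫ e^{−β S_Λ(U_v)} dσ^{free}(v)`, where `U_v` is the configuration
with the free links `v`, the forest links `1` and the cold wall `1` (`coldExt (coldExt₁ v)`), and `σ^{free}` is the product Haar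
measure on the free (non-forest) edges of the cold box — the integration variables of the one-scale expansion (and the index set of
the Dirichlet Gaussian D1', up to the bijection `dirFreeEdges H ≃ {e ∈ Λ // ¬ forest}`). -/
theorem integral_boxState_eq_coldFree (hρ : Continuous ρ) (β : ℝ) (H : ℕ) {F : LGConfig 4 G → ℝ} (hF : Measurable F)
    (hFinv : IsZdGaugeInvariant F) :
    ∫ U, F U ∂(boxState ρ β H) =
      (∫ v, F (coldExt (coldExt₁ v)) *
          Real.exp (-β * wilsonBoundaryAction ρ (boxEdges 4 (2 * H + 1)) (coldExt (coldExt₁ v)))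
        ∂(Measure.pi fun _ : {e : ↥(boxEdges 4 (2 * H + 1)) //
          ¬ (e.1.2 = 0 ∧ ∀ k : Fin 4, 1 ≤ e.1.1 k ∧ e.1.1 k + 1 ≤ 2 * (H : ℤ))} => haarProbability G)) /
      ∫ v, Real.exp (-β * wilsonBoundaryAction ρ (boxEdges 4 (2 * H + 1)) (coldExt (coldExt₁ v)))
        ∂(Measure.pi fun _ : {e : ↥(boxEdges 4 (2 * H + 1)) //
          ¬ (e.1.2 = 0 ∧ ∀ k : Fin 4, 1 ≤ e.1.1 k ∧ e.1.1 k + 1 ≤ 2 * (H : ℤ))} => haarProbability G) := by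
  have hbox : boxState ρ β H = ymSpecification ρ β (boxEdges 4 (2 * H + 1)) (fun _ => 1) := rfl
  rw [hbox, integral_ymSpecification ρ hρ β _ hF]
  have hSc : Continuous fun U : LGConfig 4 G => Real.exp (-β * wilsonBoundaryAction ρ (boxEdges 4 (2 * H + 1)) U) :=
    Real.continuous_exp.comp (continuous_const.mul (continuous_wilsonBoundaryAction ρ hρ _))
  have hglue : ∀ ζ : ColdCfg (G := G) H, glueWith (boxEdges 4 (2 * H + 1)) ζ (fun _ => (1 : G)) = coldExt ζ := fun ζ => rfl
  -- invariance of both integrands under the forest gauge fixing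
  have hinvS : ∀ u : ColdCfg (G := G) H, wilsonBoundaryAction ρ (boxEdges 4 (2 * H + 1)) (coldExt (coldFixBox u)) =
      wilsonBoundaryAction ρ (boxEdges 4 (2 * H + 1)) (coldExt u) := fun u => by
    rw [coldExt_coldFixBox, forestFix, wilsonBoundaryAction_gaugeTransformZd]
  have hinvF : ∀ u : ColdCfg (G := G) H, F (coldExt (coldFixBox u)) = F (coldExt u) := fun u => by
    rw [coldExt_coldFixBox, forestFix, hFinv]
  simp_rw [hglue]
  have h1 := integral_pi_eq_integral_coldFree (H := H)
    (Ψ := fun ζ => F (coldExt ζ) * Real.exp (-β * wilsonBoundaryAction ρ (boxEdges 4 (2 * H + 1)) (coldExt ζ)))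
    ((hF.comp measurable_coldExt).mul (hSc.measurable.comp measurable_coldExt))
    (fun u => by simp only [hinvF u, hinvS u])
  have h2 := integral_pi_eq_integral_coldFree (H := H)
    (Ψ := fun ζ => Real.exp (-β * wilsonBoundaryAction ρ (boxEdges 4 (2 * H + 1)) (coldExt ζ)))
    (hSc.measurable.comp measurable_coldExt) (fun u => by simp only [hinvS u])
  rw [h1, h2]

end BoxState

end Summit.QuantumFields.YangMills.Theorems.WeakCouplingRates

end
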